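import Summits.ValiantsHypothesis.ValiantsHypothesis.Theses.DecompCycle1C
import Literature.Computability.AlgebraicComplexity.DDS21ZariskiBorderConstFaninVBP
import HarnessLib

/-!
# DecompCycle1C — rung R2 of the residual P3: constant-top-fan-in border depth-3 ⊆ VBP

Closes the ASIDE item `BorderConstFaninDepthThreeInVBP` (stmt-ValiantsHypothesis-23713, banked rung R2
of route-ValiantsHypothesis-DecompCycle1C, EDIT-KIT_v4 §2/§3) by the landed Literature theorem
`DDS2021.isVPwsFamily_of_isBorderSPSFamily_const` (module `DDS21ZariskiBorderConstFaninVBP`, p742035):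
Dutta–Dwivedi–Saxena 2021 Thm 1.1 read in the Zariski / `VP_ws` currency — for every constant top
fan-in `k₀`, every p-bounded-variable family in the Zariski closure of `Σ^[k₀]Π^[d]Σ` with p-bounded `d`
is in `VP_ws`.  Record-only context (kind aside, bc6); its S-case (23622) is known in print, so this is
NOT a T3 witness for P1′.  Nothing here bears on `VP ≠ VNP` itself.
-/

namespace Summit.ValiantsHypothesis.ValiantsHypothesis.Theorems.DecompCycle1CBorderConstFaninR2

open Summit.ValiantsHypothesis.ValiantsHypothesis.Theses.DecompCycle1C

/-- **Rung R2 (PROVED): constant-top-fan-in border depth-3 circuits with p-bounded variables and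
p-bounded `d` compute only `VP_ws` families** — the route item `BorderConstFaninDepthThreeInVBP`,
by `DDS2021.isVPwsFamily_of_isBorderSPSFamily_const`. [cite: DuttaDwivediSaxena2022, Thm. 1.1] -/
theorem borderConstFaninDepthThreeInVBP_holds : BorderConstFaninDepthThreeInVBP :=
  Literature.Computability.AlgebraicComplexity.DDS2021.isVPwsFamily_of_isBorderSPSFamily_const

end Summit.ValiantsHypothesis.ValiantsHypothesis.Theorems.DecompCycle1CBorderConstFaninR2
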